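import Literature.NumberTheory.GaloisRepresentations.LocalReciprocityLawDischargeProofs
import HarnessLib

/-!
# The norm quotient `Mˣ ⧸ N_{L/M} Lˣ` of an ABSTRACT finite abelian extension of a local field:
# `≅ Gal(L/M)`, of order `[L : M]`, cyclic for cyclic `L/M`; every `H ≤ Mˣ` has `H ⧸ (H ∩ N Lˣ)`
# cyclic of order dividing `[L : M]` (the unit-group norm quotients `U_M ⧸ N_{L/M} U_L`)

Topic `NumberTheory/GaloisRepresentations`, namespace `Literature.NumberTheory.GaloisRepresentations`.
Theorems only (no definition, no named fact, no `sorry`).  Cell `bsd-print-cf2`, width seat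
`bsd-line-cf2c-w3` g14, `--supports` the deciding class crux `PrintCf2RubinValueTwo.MainConjClauseAtSplitTwoQuadDAClass`
(stmt-BirchSwinnertonDyer-23300) as a helper: it is the local-class-field-theory input («`T`-cyclicity») of the
LOCAL ATOM of the finite-generation half of the units stub (U1) — the uniform bound on the coinvariants of the
principal units of the layers of a `ℤ_p²`-tower of local fields (cell files `…LeopoldtUnitsFGLayerBound` and the
local bound), whose devissage needs, for a cyclic layer `L/M`, that `U_M ⧸ N_{L/M} U_L ↪ Mˣ ⧸ N_{L/M} Lˣ ≅ Gal(L/M)`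
is CYCLIC.  HONEST FRAMING: a transport lemma over the tree's local reciprocity law; nothing here closes a crux;
BSD is not advanced by this file.

## What is proved

The tree's reciprocity law `localReciprocityLaw F` (Serre XIII §4, `LocalExistenceReciprocity.lean`; PROVED:
`localReciprocityLaw_holds`, `LocalReciprocityLawDischargeProofs.lean`) is phrased for the finite abelian
intermediate fields `E` of `AlgebraicClosure F`, and the tree's abstract cyclic norm-index theorem
`index_range_unitsMap_norm_eq_finrank` (`LocalClassFieldAxiom.lean`, Neukirch V (1.1)) gives the INDEX
`[Mˣ : N Lˣ] = [L : M]` but not the STRUCTURE of the quotient.  Consumers meet ABSTRACT extensions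
(`[Algebra M L]`, e.g. a completion of a number field over the completion of a subfield) and need the quotient to
be cyclic.  For `M` a non-archimedean local field and `L/M` finite (abelian) Galois, with
`N := N_{L/M}(Lˣ) = (Units.map (Algebra.norm M)).range ≤ Mˣ`:

* `range_unitsMap_norm_eq_of_algEquiv` — `N` is invariant under `L ≃ₐ[M] L'`;
* (group theory) `quotientSubgroupOfMapSubtype_injective` (`H ⧸ (H ∩ N) ↪ G ⧸ N`),
  `isCyclic_quotient_of_subgroupOf_le`, `index_dvd_index_of_subgroupOf_le`;
* (valuations) `valuation_algebraMap_norm_eq_pow` — `v(N x) = v(x)^{[L:M]}` for a `Gal(L/M)`-invariant valuation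
  `v` on `L`; `valuation_eq_one_of_valuation_norm_eq_one`; `forall_norm_mem_exists_of_valuation` — «a norm which is
  a unit is (the norm of) a unit»: the clause below for `H ⊆ {v ∘ algebraMap = 1}`, `U ⊇ {v = 1}`;
* `exists_normResidueHom_of_isAbelianGalois` — **reciprocity for abstract `L/M`**: a surjective
  `θ : Mˣ →* Gal(L/M)` with `ker θ = N` (embed `L ↪ M̄` by `IsAlgClosed.lift`, apply `localReciprocityLaw_holds` to
  the image, pull back along `AlgHom.equivFieldRange` / `AlgEquiv.autCongr`);
* `nonempty_quotient_norm_mulEquiv_gal` — `Mˣ ⧸ N ≃* Gal(L/M)`;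
  `index_range_unitsMap_norm_eq_finrank_of_isAbelianGalois` — `[Mˣ : N] = [L : M]` (abelian, not only cyclic);
  `card_quotient_range_unitsMap_norm_eq_finrank`; `pow_finrank_mem_range_unitsMap_norm` — `x^{[L:M]} ∈ N`;
* `isCyclic_quotient_range_unitsMap_norm` — `Mˣ ⧸ N` is cyclic when `Gal(L/M)` is (`isAbelianGalois_of_isCyclic`);
* `isCyclic_quotient_of_subgroupOf_range_unitsMap_norm_le`, `index_dvd_finrank_of_subgroupOf_range_unitsMap_norm_le`
  (and the `H' = H ∩ N` cases `isCyclic_quotient_subgroupOf_range_unitsMap_norm`,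
  `index_subgroupOf_range_unitsMap_norm_dvd_finrank`) — for EVERY subgroup `H ≤ Mˣ` (the unit group, the principal
  units, …) and every `H' ≤ H` containing `H ∩ N`: `H ⧸ H'` is cyclic (cyclic `L/M`) and `[H : H']` divides `[L : M]`;
* `subgroupOf_range_le_subgroupOf_map_of_norm_mem`, `isCyclic_quotient_subgroupOf_map_norm`,
  `index_subgroupOf_map_norm_dvd_finrank`, `isCyclic_quotient_of_subgroupOf_map_norm_le` — the same for
  `H ⧸ (H ∩ N_{L/M} U)` (and its quotients) for any `U ≤ Lˣ` such that every norm landing in `H` is the norm of an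
  element of `U` — the printed `U_M ⧸ N_{L/M} U_L ↪ Gal(L/M)` (image = the inertia group, Serre V §3);
* `isCyclic_quotient_of_valuation_le`, `index_dvd_finrank_of_valuation_le` — ASSEMBLED: for cyclic `L/M`, a
  `Gal(L/M)`-invariant valuation `v` on `L`, `U_M ⊆ {v ∘ algebraMap = 1}`, `U_L ⊇ {v = 1}` and any
  `H' ⊇ U_M ∩ N_{L/M} U_L`: `U_M ⧸ H'` is cyclic and `[U_M : H']` divides `[L : M]` (the `T`-cyclicity input).

## References
* J.-P. Serre, *Local Fields*, GTM 67, Springer 1979, Ch. XIII §4 Cor. to Prop. 8, Prop. 9; Ch. V §3.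
  [SerreLocalFields1979]
* J. Neukirch, *Algebraic Number Theory*, Springer 1999, Ch. V §1 Thm. (1.3), (1.4). [NeukirchANT1999]
-/

noncomputable section

open Function

namespace Literature.NumberTheory.GaloisRepresentations

universe u v w

/-! ### Transport of the norm subgroup along `M`-isomorphisms -/

section Transport

variable {M : Type u} [Field M] {L : Type v} {L' : Type w} [Field L] [Field L'] [Algebra M L] [Algebra M L']

/-- **The norm subgroup is invariant under `M`-isomorphisms**: `N_{L/M}(Lˣ) = N_{L'/M}(L'ˣ)` in `Mˣ`
for `L ≃ₐ[M] L'` (`Algebra.norm_eq_of_algEquiv`) — the transport step of the reciprocity law to abstract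
extensions. [cite: NeukirchANT1999, Ch. V §1 Thm. (1.3)] -/
theorem range_unitsMap_norm_eq_of_algEquiv (e : L ≃ₐ[M] L') :
    (Units.map (Algebra.norm M (S := L) : L →* M)).range =
      (Units.map (Algebra.norm M (S := L') : L' →* M)).range := by
  ext u
  constructor
  · rintro ⟨y, rfl⟩
    refine ⟨Units.map (e : L →+* L').toMonoidHom y, Units.ext ?_⟩
    change Algebra.norm M (e (y : L)) = Algebra.norm M (y : L)
    exact Algebra.norm_eq_of_algEquiv e _
  · rintro ⟨y', rfl⟩
    refine ⟨Units.map (e.symm : L' →+* L).toMonoidHom y', Units.ext ?_⟩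
    change Algebra.norm M (e.symm (y' : L')) = Algebra.norm M (y' : L')
    exact Algebra.norm_eq_of_algEquiv e.symm _

end Transport

/-! ### Pure group theory: `H ⧸ (H ∩ N) ↪ G ⧸ N` and its quotients -/

section Group

variable {G : Type u} [Group G]

/-- For `H ≤ G` and a normal `N ≤ G`, the map `H ⧸ (H ∩ N) → G ⧸ N` is injective (its kernel `N.subgroupOf H`
is exactly what is divided out) — the group theory behind `U_K ⧸ N U_L ↪ K* ⧸ N L*`.
[cite: SerreLocalFields1979, Ch. V §3] -/
theorem quotientSubgroupOfMapSubtype_injective (H N : Subgroup G) [N.Normal] :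
    Injective (QuotientGroup.map (N.subgroupOf H) N H.subtype (fun _ h => h)) := by
  rw [← MonoidHom.ker_eq_bot_iff, eq_bot_iff]
  intro x hx
  induction x using QuotientGroup.induction_on with
  | H h =>
    rw [MonoidHom.mem_ker, QuotientGroup.map_mk, QuotientGroup.eq_one_iff] at hx
    rw [Subgroup.mem_bot, QuotientGroup.eq_one_iff, Subgroup.mem_subgroupOf]
    exact hx

/-- If `G ⧸ N` is cyclic then so is `H ⧸ H'` for every `H ≤ G` and every normal `H' ≤ H` containing `H ∩ N`
(the group theory behind `U_K ⧸ N U_L ↪ K* ⧸ N L*`). [cite: SerreLocalFields1979, Ch. V §3] -/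
theorem isCyclic_quotient_of_subgroupOf_le (H N : Subgroup G) [N.Normal] [IsCyclic (G ⧸ N)]
    (H' : Subgroup H) [H'.Normal] (hle : N.subgroupOf H ≤ H') : IsCyclic (H ⧸ H') := by
  haveI : IsCyclic (H ⧸ N.subgroupOf H) :=
    isCyclic_of_injective (QuotientGroup.map (N.subgroupOf H) N H.subtype (fun _ h => h))
      (quotientSubgroupOfMapSubtype_injective H N)
  refine isCyclic_of_surjective (QuotientGroup.map (N.subgroupOf H) H' (MonoidHom.id H) hle) (fun x => ?_)
  induction x using QuotientGroup.induction_on with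
  | H h => exact ⟨QuotientGroup.mk h, rfl⟩

/-- `[H : H']` divides `[G : N]` for every `H ≤ G` and every `H' ≤ H` containing `H ∩ N` (the group theory
behind `U_K ⧸ N U_L ↪ K* ⧸ N L*`). [cite: SerreLocalFields1979, Ch. V §3] -/
theorem index_dvd_index_of_subgroupOf_le (H N : Subgroup G) [N.Normal] (H' : Subgroup H)
    (hle : N.subgroupOf H ≤ H') : H'.index ∣ N.index := by
  refine (Subgroup.index_dvd_of_le hle).trans ?_
  rw [Subgroup.index_eq_card, Subgroup.index_eq_card]
  exact Subgroup.card_dvd_of_injective _ (quotientSubgroupOfMapSubtype_injective H N)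

end Group

/-! ### «A norm which is a unit is a unit»: the clause from a Galois-invariant valuation on `L` -/

section Valuation

variable {M : Type u} [Field M] (L : Type v) [Field L] [Algebra M L] [FiniteDimensional M L]
variable {Γ₀ : Type w} [LinearOrderedCommGroupWithZero Γ₀] (v : Valuation L Γ₀)

/-- For a finite Galois `L/M` and a `Gal(L/M)`-invariant valuation `v` on `L` (e.g. THE valuation of a local
field `L`): `v(N_{L/M} x) = v(x)^{[L:M]}` (the norm is the product of the conjugates,
`Algebra.norm_eq_prod_automorphisms`). [cite: SerreLocalFields1979, Ch. II §2 Cor. 2 to Prop. 3] -/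
theorem valuation_algebraMap_norm_eq_pow [IsGalois M L] (hv : ∀ (σ : L ≃ₐ[M] L) (x : L), v (σ x) = v x)
    (x : L) : v (algebraMap M L (Algebra.norm M x)) = v x ^ Module.finrank M L := by
  rw [Algebra.norm_eq_prod_automorphisms, map_prod, Finset.prod_congr rfl (fun σ _ => hv σ x),
    Finset.prod_const, Finset.card_univ, ← Nat.card_eq_fintype_card, IsGalois.card_aut_eq_finrank]

/-- Hence `v(N_{L/M} x) = 1 → v(x) = 1` (a linearly ordered value group has no torsion).
[cite: SerreLocalFields1979, Ch. II §2 Cor. 2 to Prop. 3] -/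
theorem valuation_eq_one_of_valuation_norm_eq_one [IsGalois M L]
    (hv : ∀ (σ : L ≃ₐ[M] L) (x : L), v (σ x) = v x) {x : L}
    (h : v (algebraMap M L (Algebra.norm M x)) = 1) : v x = 1 := by
  rw [valuation_algebraMap_norm_eq_pow L v hv] at h
  have hn : Module.finrank M L ≠ 0 := Module.finrank_pos.ne'
  exact le_antisymm ((pow_le_one_iff hn).mp h.le) ((one_le_pow_iff hn).mp h.ge)

/-- **The clause «every norm landing in `H` is the norm of an element of `U`» holds for `H ⊆ {v ∘ algebraMap = 1}`
and `U ⊇ {v = 1}`** (e.g. `H = U_M`, `U = U_L` the unit groups of a Galois-invariant valuation): a norm which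
is a unit is the norm of a unit — indeed of the same element. [cite: SerreLocalFields1979, Ch. II §2 Cor. 2 to Prop. 3] -/
theorem forall_norm_mem_exists_of_valuation [IsGalois M L] (hv : ∀ (σ : L ≃ₐ[M] L) (x : L), v (σ x) = v x)
    (H : Subgroup Mˣ) (U : Subgroup Lˣ) (hH : ∀ x : Mˣ, x ∈ H → v (algebraMap M L x) = 1)
    (hU : ∀ x : Lˣ, v x = 1 → x ∈ U) :
    ∀ x : Lˣ, Units.map (Algebra.norm M (S := L) : L →* M) x ∈ H →
      ∃ u ∈ U, Units.map (Algebra.norm M (S := L) : L →* M) u = Units.map (Algebra.norm M (S := L) : L →* M) x :=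
  fun x hx => ⟨x, hU x (valuation_eq_one_of_valuation_norm_eq_one L v hv (hH _ hx)), rfl⟩

end Valuation

/-! ### Reciprocity for abstract finite abelian extensions of a local field -/

section Local

variable (M : Type u) [Field M] [ValuativeRel M] [TopologicalSpace M] [IsNonarchimedeanLocalField M]
variable (L : Type v) [Field L] [Algebra M L] [FiniteDimensional M L]

/-- **The local reciprocity law for an ABSTRACT finite abelian extension `L/M`** of a non-archimedean local
field `M`: there is a surjective homomorphism `θ : Mˣ →* Gal(L/M)` (a norm residue symbol) with kernel
`N_{L/M}(Lˣ)`.  From the tree's `localReciprocityLaw_holds` (stated for subfields of `M̄`) by embedding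
`L ↪ M̄` (`IsAlgClosed.lift`) and transporting along `L ≃ₐ[M] image`.
[cite: SerreLocalFields1979, Ch. XIII §4 Cor. to Prop. 8] -/
theorem exists_normResidueHom_of_isAbelianGalois [IsAbelianGalois M L] :
    ∃ θ : Mˣ →* (L ≃ₐ[M] L), Surjective θ ∧
      θ.ker = (Units.map (Algebra.norm M (S := L) : L →* M)).range := by
  obtain ⟨θ, hθ⟩ := localReciprocityLaw_holds M
  haveI : Algebra.IsAlgebraic M L := Algebra.IsAlgebraic.of_finite M L
  let φ : L →ₐ[M] AlgebraicClosure M := IsAlgClosed.lift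
  let e : L ≃ₐ[M] φ.fieldRange := φ.equivFieldRange
  haveI : FiniteDimensional M φ.fieldRange := LinearEquiv.finiteDimensional e.toLinearEquiv
  haveI : IsAbelianGalois M φ.fieldRange := IsAbelianGalois.of_algHom (e.symm : φ.fieldRange →ₐ[M] L)
  obtain ⟨hsurj, hker, -⟩ := hθ φ.fieldRange
  refine ⟨((e.autCongr.symm : (φ.fieldRange ≃ₐ[M] φ.fieldRange) ≃* (L ≃ₐ[M] L)) :
      (φ.fieldRange ≃ₐ[M] φ.fieldRange) →* (L ≃ₐ[M] L)).comp (θ φ.fieldRange),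
    e.autCongr.symm.surjective.comp hsurj, ?_⟩
  rw [MonoidHom.ker_mulEquiv_comp, hker, range_unitsMap_norm_eq_of_algEquiv e.symm]

/-- **`Mˣ ⧸ N_{L/M}(Lˣ) ≅ Gal(L/M)`** for an abstract finite abelian extension of a non-archimedean local
field. [cite: SerreLocalFields1979, Ch. XIII §4 Cor. to Prop. 8] -/
theorem nonempty_quotient_norm_mulEquiv_gal [IsAbelianGalois M L] :
    Nonempty (Mˣ ⧸ (Units.map (Algebra.norm M (S := L) : L →* M)).range ≃* (L ≃ₐ[M] L)) := by
  obtain ⟨θ, hsurj, hker⟩ := exists_normResidueHom_of_isAbelianGalois M L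
  exact ⟨(QuotientGroup.quotientMulEquivOfEq hker.symm).trans
    (QuotientGroup.quotientKerEquivOfSurjective θ hsurj)⟩

/-- **The fundamental equality for abstract ABELIAN `L/M`**: `[Mˣ : N_{L/M}(Lˣ)] = [L : M]` (the cyclic case is
the tree's `index_range_unitsMap_norm_eq_finrank`). [cite: SerreLocalFields1979, Ch. XIII §4 Prop. 9] -/
theorem index_range_unitsMap_norm_eq_finrank_of_isAbelianGalois [IsAbelianGalois M L] :
    (Units.map (Algebra.norm M (S := L) : L →* M)).range.index = Module.finrank M L := by
  obtain ⟨θ, hsurj, hker⟩ := exists_normResidueHom_of_isAbelianGalois M L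
  rw [← hker, Subgroup.index_ker, MonoidHom.range_eq_top.mpr hsurj, Subgroup.card_top,
    IsGalois.card_aut_eq_finrank]

/-- `Nat.card (Mˣ ⧸ N_{L/M}(Lˣ)) = [L : M]` (finite abelian `L/M`). [cite: SerreLocalFields1979, Ch. XIII §4 Prop. 9] -/
theorem card_quotient_range_unitsMap_norm_eq_finrank [IsAbelianGalois M L] :
    Nat.card (Mˣ ⧸ (Units.map (Algebra.norm M (S := L) : L →* M)).range) = Module.finrank M L := by
  rw [← Subgroup.index_eq_card, index_range_unitsMap_norm_eq_finrank_of_isAbelianGalois M L]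

/-- Every `[L : M]`-th power in `Mˣ` is a norm from `L` (finite abelian `L/M`): `(Mˣ)^{[L:M]} ≤ N_{L/M}(Lˣ)`.
[cite: SerreLocalFields1979, Ch. XIII §4 Prop. 9] -/
theorem pow_finrank_mem_range_unitsMap_norm [IsAbelianGalois M L] (x : Mˣ) :
    x ^ Module.finrank M L ∈ (Units.map (Algebra.norm M (S := L) : L →* M)).range := by
  rw [← QuotientGroup.eq_one_iff, QuotientGroup.mk_pow, ← card_quotient_range_unitsMap_norm_eq_finrank M L]
  exact pow_card_eq_one'

omit [ValuativeRel M] [TopologicalSpace M] [IsNonarchimedeanLocalField M] [FiniteDimensional M L] in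
/-- A CYCLIC Galois extension is abelian. [cite: NeukirchANT1999, Ch. V §1 Thm. (1.3)] -/
theorem isAbelianGalois_of_isCyclic [IsGalois M L] [IsCyclic (L ≃ₐ[M] L)] : IsAbelianGalois M L :=
  IsAbelianGalois.mk

/-- **`Mˣ ⧸ N_{L/M}(Lˣ)` is cyclic for a cyclic extension `L/M`** of a non-archimedean local field.
[cite: SerreLocalFields1979, Ch. XIII §4 Cor. to Prop. 8] -/
theorem isCyclic_quotient_range_unitsMap_norm [IsGalois M L] [IsCyclic (L ≃ₐ[M] L)] :
    IsCyclic (Mˣ ⧸ (Units.map (Algebra.norm M (S := L) : L →* M)).range) := by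
  haveI := isAbelianGalois_of_isCyclic M L
  obtain ⟨e⟩ := nonempty_quotient_norm_mulEquiv_gal M L
  exact isCyclic_of_surjective (e.symm : (L ≃ₐ[M] L) →* Mˣ ⧸ (Units.map (Algebra.norm M (S := L) : L →* M)).range)
    e.symm.surjective

/-! ### Norm quotients of subgroups `H ≤ Mˣ` (unit groups) -/

/-- **`H ⧸ H'` is cyclic for every `H ≤ Mˣ` and every normal `H' ≤ H` containing `H ∩ N_{L/M} Lˣ`** when `L/M`
is cyclic — in particular `U_M ⧸ N_{L/M} U_L` (`↪ Mˣ ⧸ N Lˣ ≅ Gal(L/M)`) and its quotients, for the unit group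
or the principal units. [cite: SerreLocalFields1979, Ch. V §3 and Ch. XIII §4 Cor. to Prop. 8] -/
theorem isCyclic_quotient_of_subgroupOf_range_unitsMap_norm_le [IsGalois M L] [IsCyclic (L ≃ₐ[M] L)]
    (H : Subgroup Mˣ) (H' : Subgroup H) [H'.Normal]
    (hle : ((Units.map (Algebra.norm M (S := L) : L →* M)).range).subgroupOf H ≤ H') :
    IsCyclic (H ⧸ H') := by
  haveI := isCyclic_quotient_range_unitsMap_norm M L
  exact isCyclic_quotient_of_subgroupOf_le H _ H' hle

/-- **`[H : H']` divides `[L : M]`** for every `H ≤ Mˣ` and `H' ≤ H` containing `H ∩ N_{L/M} Lˣ` (finite abelian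
`L/M`). [cite: SerreLocalFields1979, Ch. XIII §4 Prop. 9] -/
theorem index_dvd_finrank_of_subgroupOf_range_unitsMap_norm_le [IsAbelianGalois M L]
    (H : Subgroup Mˣ) (H' : Subgroup H)
    (hle : ((Units.map (Algebra.norm M (S := L) : L →* M)).range).subgroupOf H ≤ H') :
    H'.index ∣ Module.finrank M L := by
  rw [← index_range_unitsMap_norm_eq_finrank_of_isAbelianGalois M L]
  exact index_dvd_index_of_subgroupOf_le H _ H' hle

/-- `H ⧸ (H ∩ N_{L/M} Lˣ)` is cyclic for every `H ≤ Mˣ` (cyclic `L/M`).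
[cite: SerreLocalFields1979, Ch. XIII §4 Cor. to Prop. 8] -/
theorem isCyclic_quotient_subgroupOf_range_unitsMap_norm [IsGalois M L] [IsCyclic (L ≃ₐ[M] L)]
    (H : Subgroup Mˣ) :
    IsCyclic (H ⧸ ((Units.map (Algebra.norm M (S := L) : L →* M)).range).subgroupOf H) :=
  isCyclic_quotient_of_subgroupOf_range_unitsMap_norm_le M L H _ le_rfl

/-- `[H : H ∩ N_{L/M} Lˣ]` divides `[L : M]` for every `H ≤ Mˣ` (finite abelian `L/M`).
[cite: SerreLocalFields1979, Ch. XIII §4 Prop. 9] -/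
theorem index_subgroupOf_range_unitsMap_norm_dvd_finrank [IsAbelianGalois M L] (H : Subgroup Mˣ) :
    (((Units.map (Algebra.norm M (S := L) : L →* M)).range).subgroupOf H).index ∣ Module.finrank M L :=
  index_dvd_finrank_of_subgroupOf_range_unitsMap_norm_le M L H _ le_rfl

/-! ### The unit-group form: `H ⧸ (H ∩ N_{L/M} U)` for `U ≤ Lˣ` whose norms exhaust the norms landing in `H` -/

omit [ValuativeRel M] [TopologicalSpace M] [IsNonarchimedeanLocalField M] [FiniteDimensional M L] in
/-- If every norm from `Lˣ` that lands in `H` is the norm of an element of `U ≤ Lˣ` («a norm which is a unit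
is the norm of a unit» — from the valuation of `L`, supplied by the consumer), then
`H ∩ N_{L/M}(Lˣ) ≤ H ∩ N_{L/M}(U)` as subgroups of `H`. [cite: SerreLocalFields1979, Ch. V §3] -/
theorem subgroupOf_range_le_subgroupOf_map_of_norm_mem (H : Subgroup Mˣ) (U : Subgroup Lˣ)
    (hU : ∀ x : Lˣ, Units.map (Algebra.norm M (S := L) : L →* M) x ∈ H →
      ∃ u ∈ U, Units.map (Algebra.norm M (S := L) : L →* M) u = Units.map (Algebra.norm M (S := L) : L →* M) x) :
    ((Units.map (Algebra.norm M (S := L) : L →* M)).range).subgroupOf H ≤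
      (U.map (Units.map (Algebra.norm M (S := L) : L →* M))).subgroupOf H := by
  intro h hh
  rw [Subgroup.mem_subgroupOf] at hh ⊢
  obtain ⟨x, hx⟩ := hh
  obtain ⟨u, huU, hu⟩ := hU x (hx ▸ h.2)
  exact ⟨u, huU, hu.trans hx⟩

/-- **`U_M ⧸ N_{L/M} U_L` is cyclic for cyclic `L/M`** — abstract form: for `H ≤ Mˣ` and `U ≤ Lˣ` such that every
norm landing in `H` is the norm of an element of `U`, `H ⧸ (H ∩ N_{L/M} U)` is cyclic (it embeds in
`Mˣ ⧸ N_{L/M} Lˣ ≅ Gal(L/M)`).  With `H = U_M`, `U = U_L` (resp. the principal units) this is the cyclicity of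
`U_M ⧸ N_{L/M} U_L`. [cite: SerreLocalFields1979, Ch. V §3 and Ch. XIII §4 Cor. to Prop. 8] -/
theorem isCyclic_quotient_subgroupOf_map_norm [IsGalois M L] [IsCyclic (L ≃ₐ[M] L)]
    (H : Subgroup Mˣ) (U : Subgroup Lˣ)
    (hU : ∀ x : Lˣ, Units.map (Algebra.norm M (S := L) : L →* M) x ∈ H →
      ∃ u ∈ U, Units.map (Algebra.norm M (S := L) : L →* M) u = Units.map (Algebra.norm M (S := L) : L →* M) x) :
    IsCyclic (H ⧸ (U.map (Units.map (Algebra.norm M (S := L) : L →* M))).subgroupOf H) :=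
  isCyclic_quotient_of_subgroupOf_range_unitsMap_norm_le M L H _
    (subgroupOf_range_le_subgroupOf_map_of_norm_mem M L H U hU)

/-- `[H : H ∩ N_{L/M} U]` divides `[L : M]` under the same hypothesis (finite abelian `L/M`).
[cite: SerreLocalFields1979, Ch. XIII §4 Prop. 9] -/
theorem index_subgroupOf_map_norm_dvd_finrank [IsAbelianGalois M L]
    (H : Subgroup Mˣ) (U : Subgroup Lˣ)
    (hU : ∀ x : Lˣ, Units.map (Algebra.norm M (S := L) : L →* M) x ∈ H →
      ∃ u ∈ U, Units.map (Algebra.norm M (S := L) : L →* M) u = Units.map (Algebra.norm M (S := L) : L →* M) x) :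
    ((U.map (Units.map (Algebra.norm M (S := L) : L →* M))).subgroupOf H).index ∣ Module.finrank M L :=
  index_dvd_finrank_of_subgroupOf_range_unitsMap_norm_le M L H _
    (subgroupOf_range_le_subgroupOf_map_of_norm_mem M L H U hU)

/-- Any quotient `H ⧸ H'` with `H' ⊇ H ∩ N_{L/M} U` — e.g. `T = U¹_M ⧸ (U¹_{M₀} · N_{L/M} U¹_L)` of the devissage —
is cyclic (cyclic `L/M`, `U` as above). [cite: SerreLocalFields1979, Ch. XIII §4 Cor. to Prop. 8] -/
theorem isCyclic_quotient_of_subgroupOf_map_norm_le [IsGalois M L] [IsCyclic (L ≃ₐ[M] L)]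
    (H : Subgroup Mˣ) (U : Subgroup Lˣ)
    (hU : ∀ x : Lˣ, Units.map (Algebra.norm M (S := L) : L →* M) x ∈ H →
      ∃ u ∈ U, Units.map (Algebra.norm M (S := L) : L →* M) u = Units.map (Algebra.norm M (S := L) : L →* M) x)
    (H' : Subgroup H) [H'.Normal] (hle : (U.map (Units.map (Algebra.norm M (S := L) : L →* M))).subgroupOf H ≤ H') :
    IsCyclic (H ⧸ H') :=
  isCyclic_quotient_of_subgroupOf_range_unitsMap_norm_le M L H H'
    ((subgroupOf_range_le_subgroupOf_map_of_norm_mem M L H U hU).trans hle)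

/-! ### Assembled: unit groups of a Galois-invariant valuation -/

/-- **`U_M ⧸ N_{L/M} U_L` (and every quotient `U_M ⧸ H'`, `H' ⊇ U_M ∩ N_{L/M} U_L`) is cyclic for a cyclic extension
`L/M` of a non-archimedean local field `M`**, where `U_L ⊇ {v = 1}` and `U_M ⊆ {v ∘ algebraMap = 1}` for a
`Gal(L/M)`-invariant valuation `v` on `L` — the form consumed per place by the local bound of the units atom
(`T`-cyclicity). [cite: SerreLocalFields1979, Ch. V §3 and Ch. XIII §4 Cor. to Prop. 8] -/
theorem isCyclic_quotient_of_valuation_le {Γ₀ : Type w} [LinearOrderedCommGroupWithZero Γ₀] (v : Valuation L Γ₀)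
    [IsGalois M L] [IsCyclic (L ≃ₐ[M] L)] (hv : ∀ (σ : L ≃ₐ[M] L) (x : L), v (σ x) = v x)
    (H : Subgroup Mˣ) (U : Subgroup Lˣ) (hH : ∀ x : Mˣ, x ∈ H → v (algebraMap M L x) = 1)
    (hU : ∀ x : Lˣ, v x = 1 → x ∈ U)
    (H' : Subgroup H) [H'.Normal] (hle : (U.map (Units.map (Algebra.norm M (S := L) : L →* M))).subgroupOf H ≤ H') :
    IsCyclic (H ⧸ H') :=
  isCyclic_quotient_of_subgroupOf_map_norm_le M L H U (forall_norm_mem_exists_of_valuation L v hv H U hH hU) H' hle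

/-- Index form: `[U_M : H']` divides `[L : M]` for every `H' ⊇ U_M ∩ N_{L/M} U_L` (finite cyclic `L/M`, `v` as above).
[cite: SerreLocalFields1979, Ch. XIII §4 Prop. 9] -/
theorem index_dvd_finrank_of_valuation_le {Γ₀ : Type w} [LinearOrderedCommGroupWithZero Γ₀] (v : Valuation L Γ₀)
    [IsGalois M L] [IsCyclic (L ≃ₐ[M] L)] (hv : ∀ (σ : L ≃ₐ[M] L) (x : L), v (σ x) = v x)
    (H : Subgroup Mˣ) (U : Subgroup Lˣ) (hH : ∀ x : Mˣ, x ∈ H → v (algebraMap M L x) = 1)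
    (hU : ∀ x : Lˣ, v x = 1 → x ∈ U)
    (H' : Subgroup H) (hle : (U.map (Units.map (Algebra.norm M (S := L) : L →* M))).subgroupOf H ≤ H') :
    H'.index ∣ Module.finrank M L :=
  haveI := isAbelianGalois_of_isCyclic M L
  index_dvd_finrank_of_subgroupOf_range_unitsMap_norm_le M L H H'
    ((subgroupOf_range_le_subgroupOf_map_of_norm_mem M L H U
      (forall_norm_mem_exists_of_valuation L v hv H U hH hU)).trans hle)

end Local

end Literature.NumberTheory.GaloisRepresentations
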